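import Mathlib
import HarnessLib
import Literature.Analysis.FluidPDE.Tao2016AveragedNS.SelfSimilarCascadeResidues
import Literature.Analysis.FluidPDE.Tao2016AveragedNS.CascadeFrontFloors
import Summits.NavierStokesRegularity.NavierStokesRegularity.Theorems.TaoLadderRungTwoBreakNoSurvivingDSSOneLeakyFront
import Summits.NavierStokesRegularity.NavierStokesRegularity.Theorems.TaoLadderRungTwoBreakNoSurvivingDSSOneLeakyFrontProfile
import Summits.NavierStokesRegularity.NavierStokesRegularity.Theorems.TaoLadderRungTwoBreakNoSurvivingDSSOneActionFloor

/-!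
# Crux `TaoLadderRungTwoBreak.NoSurvivingDSSOne` (stmt-NavierStokesRegularity-20205): the WIDE-FRONT INEQUALITY for weakly damped
# profile systems — gain asymmetry × action is bounded BELOW, with a constant exponential only in the INSTANTANEOUS mass

MODEL statements about lattice profile systems (Tao 2016 §4; cell vocabulary `IsSWave`, `sEnergy`, `sMass`, `sFlux`, `STable`); nothing
here concerns the Navier–Stokes equations; no stub, crux or summit is closed (`--supports stmt-NavierStokesRegularity-20205`).

`IsSWave.asymmetry_mul_action_ge` — for a NON-TRIVIAL profile family of the `(d, c₁, c₂, T)`-system of an S-table (`d > 0`,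
`0 < c₂ ≤ γ₁ := c₁e^{−2dT}`; bounded profiles, integrable mass `∫sMass ≤ A`, instantaneous mass `sMass ≤ M`, weighted energy bounded on a
right half-line), every mass threshold `δ₀ > 0` with `8c₂C_ATδ₀ ≤ 1` and leak budget `4·(2(γ₁−c₂)C_A)·A ≤ 1` satisfies
**`δ₀² ≤ 32·(γ₁ − c₂)·C_A·A·e^{k}·max(δ₀², q·M²)`**, `k = (2c₂C_A(M+δ₀) + 2(γ₁−c₂)C_A·M)·T`, `q = card ρ`.
Compare the tree's action inequality (`…ActionFloor.sWave_one_le_asymmetry_mul_action`: `1 ≤ 2C_A·A·|γ₁−c₂|·e^{H}`, `H ∝ C_A·A`):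
here the exponential carries the INSTANTANEOUS mass `M` and the lag `T`, the action `A` enters only LINEARLY — the inequality for WIDE
fronts (`A ≫ M`).  Mechanism: Theorem A′ with leak (`…LeakyFront`, `…LeakyFrontProfile`: plateau/gap/threshold with the weight origin at
the leading edge `a`) bounds the weighted energy everywhere by `max(M², 16·Rsq_a·e^{k})` (`Rsq_a` the residue seen from `a`), and the
wake–throughput identity (`…ActionFloor.residue_le_asymmetry`) bounds `Rsq_a ≤ 2(γ₁−c₂)C_A·(that peak)·A`.
For the rescaled surviving DSS wave (`smallRatio_normalForm`: `d = ε₀`, `γ₁ − c₂ = Λ⁻¹(1/μ − 1) ≤ ε₀`, `T = τ < 5/2`, `M = ε₀·sup sMass Φ`,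
`A = ∫sMass Φ`) this reads `ε₀ ≥ δ₀²e^{−k}/(32C_A·A·max(δ₀², qM²))`: the WIDE-FRONT SLICE of K1(1) (next hand: the instantiation in ⟨20205⟩'s
binders).  HONEST LABEL: ⟨20205⟩, (ρ0) and every NS statement remain OPEN.
-/

noncomputable section

-- the summit and its single sub-problem share the name (CONVENTIONS §1)
set_option linter.dupNamespace false

namespace Summit.NavierStokesRegularity.NavierStokesRegularity.Theorems.NoSurvivingDSSOne.LeakyFront

open Set Filter Topology MeasureTheory intervalIntegral
open scoped RealInnerProductSpace
open Literature.Analysis.FluidPDE Literature.Analysis.FluidPDE.TaoCascade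
open Summit.NavierStokesRegularity.NavierStokesRegularity.Theorems.NoSurvivingDSSOne.ActionFloor
  (residue_le_asymmetry tendsto_weighted_sEnergy_atBot)

variable {V : Type*} [NormedAddCommGroup V] [InnerProductSpace ℝ V]
variable {ρ : Type*} [Fintype ρ]

omit [InnerProductSpace ℝ V] in
/-- `sEnergy ≤ sMass²` (public copy of the tree's private lemma). [folklore] -/
theorem sEnergy_le_sMass_sq' (Φ : ρ → ℝ → V) (x : ℝ) : sEnergy Φ x ≤ sMass Φ x ^ 2 := by
  unfold sEnergy sMass
  rw [sq, Finset.sum_mul]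
  refine Finset.sum_le_sum fun r _ => ?_
  rw [sq]
  exact mul_le_mul_of_nonneg_left (Finset.single_le_sum (f := fun r => ‖Φ r x‖) (fun i _ => norm_nonneg _)
    (Finset.mem_univ r)) (norm_nonneg _)

/-- **Leaky-front dichotomy with the plateau and gap bounds exported** (the weight origin at the leading edge `a`): under the hypotheses of
`IsSWave.weighted_trailing_floor_leak`, either `e^{2dx}E ≤ 4L` everywhere, or there is `a` with `sMass(a) ≥ δ₀`,
`e^{2d(x−a)}E(x) ≤ 4·Le^{−2da}` on `[a+T, ∞)` and `e^{2d(x−a)}E(x) ≤ 8·Le^{−2da}·e^{k}` on `[a, a+T]`.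
[cite: Tao2016AveragedNS, §4 Lemma 4.1 (4.8)–(4.9) with (4.3); adapted from the cell theorem A′ (CascadeFrontFloors)] -/
theorem IsSWave.leaky_front_dichotomy {π : Equiv.Perm ρ} {Q A : V → V} {B : V → V → V}
    {CA d c₁ c₂ T : ℝ} (hS : STable Q A B CA) (hT : 0 < T) (hc₂ : 0 < c₂)
    (hc : c₂ ≤ c₁ * Real.exp (-(2 * d * T))) {Φ : ρ → ℝ → V} (hΦ : IsSWave π Q A B d c₁ c₂ T Φ)
    {M L δ₀ Aint : ℝ} (hM : ∀ x, sMass Φ x ≤ M) (hL : 0 ≤ L)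
    (hev : ∃ S₀, ∀ x, S₀ ≤ x → Real.exp (2 * d * x) * sEnergy Φ x ≤ L)
    (hint : ∀ a b, a ≤ b → ∫ x in a..b, sMass Φ x ≤ Aint)
    (hδ₀ : 0 < δ₀) (hCTδ : 8 * (c₂ * CA) * T * δ₀ ≤ 1)
    (hρA : 4 * (2 * (c₁ * Real.exp (-(2 * d * T)) - c₂) * CA) * Aint ≤ 1) :
    (∀ x, Real.exp (2 * d * x) * sEnergy Φ x ≤ 4 * L) ∨
      ∃ a, δ₀ ≤ sMass Φ a ∧
        (∀ x, a + T ≤ x → Real.exp (2 * d * (x - a)) * sEnergy Φ x ≤ 4 * (L * Real.exp (-(2 * d * a)))) ∧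
        (∀ x, a ≤ x → x ≤ a + T → Real.exp (2 * d * (x - a)) * sEnergy Φ x ≤ 2 * (4 * (L * Real.exp (-(2 * d * a))))
          * Real.exp ((2 * (c₂ * CA) * (M + δ₀) + (2 * (c₁ * Real.exp (-(2 * d * T)) - c₂) * CA) * M) * T)) := by
  -- same package as in `IsSWave.weighted_trailing_floor_leak`
  have hCA := hS.CA_nonneg
  have hM0 : 0 ≤ M := le_trans (sMass_nonneg Φ 0) (hM 0)
  set κ₁ : ℝ := c₁ * Real.exp (-(2 * d * T)) with hκ₁
  set C : ℝ := c₂ * CA with hCdef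
  set ρ₀ : ℝ := 2 * (κ₁ - c₂) * CA with hρ₀def
  have hC0 : 0 ≤ C := by rw [hCdef]; positivity
  have hκc : 0 ≤ κ₁ - c₂ := by rw [hκ₁]; linarith
  have hρ₀0 : 0 ≤ ρ₀ := by rw [hρ₀def]; positivity
  have cF := hΦ.continuous_sFlux hS
  have cM := hΦ.continuous_sMass
  obtain ⟨S₀, hS₀⟩ := hev
  set E : ℝ → ℝ → ℝ := fun a₀ x => Real.exp (2 * d * (x - a₀)) * sEnergy Φ x with hE
  set F : ℝ → ℝ → ℝ := fun a₀ x => c₂ * (Real.exp (2 * d * (x - a₀)) * sFlux π A T Φ x) with hF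
  set R : ℝ → ℝ → ℝ := fun a₀ x =>
    2 * (κ₁ - c₂) * (Real.exp (2 * d * (x + T - a₀)) * sFlux π A T Φ (x + T)) with hR
  have hderivP : ∀ a₀ s, HasDerivAt (E a₀) (2 * (F a₀ (s + T) - F a₀ s) + R a₀ s) s := by
    intro a₀ s
    have h1 : HasDerivAt (fun x => Real.exp (2 * d * (x - a₀))) (Real.exp (2 * d * (s - a₀)) * (2 * d * 1)) s := by
      have : HasDerivAt (fun x => 2 * d * (x - a₀)) (2 * d * 1) s := by
        simpa using ((hasDerivAt_id s).sub_const a₀).const_mul (2 * d)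
      exact this.exp
    refine (h1.mul (hasDerivAt_sEnergy hS hΦ s)).congr_deriv ?_
    have ex1 : Real.exp (2 * d * (s + T - a₀)) = Real.exp (2 * d * (s - a₀)) * Real.exp (2 * d * T) := by
      rw [← Real.exp_add]; congr 1; ring
    have ex2 : Real.exp (-(2 * d * T)) * Real.exp (2 * d * T) = 1 := by
      rw [Real.exp_neg, inv_mul_cancel₀ (Real.exp_pos _).ne']
    simp only [hF, hR, hκ₁, ex1]
    linear_combination (-(2 * c₁ * Real.exp (2 * d * (s - a₀)) * sFlux π A T Φ (s + T))) * ex2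
  have hfluxP : ∀ a₀ σ, |F a₀ σ| ≤ C * E a₀ σ * sMass Φ (σ - T) := by
    intro a₀ σ
    have hw := Real.exp_pos (2 * d * (σ - a₀))
    simp only [hF, hE, hCdef]
    rw [abs_mul, abs_of_pos hc₂, abs_mul, abs_of_pos hw]
    calc c₂ * (Real.exp (2 * d * (σ - a₀)) * |sFlux π A T Φ σ|)
        ≤ c₂ * (Real.exp (2 * d * (σ - a₀)) * (CA * sEnergy Φ σ * sMass Φ (σ - T))) :=
          mul_le_mul_of_nonneg_left (mul_le_mul_of_nonneg_left (abs_sFlux_le hS π T Φ σ) hw.le) hc₂.le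
      _ = c₂ * CA * (Real.exp (2 * d * (σ - a₀)) * sEnergy Φ σ) * sMass Φ (σ - T) := by ring
  have hrP : ∀ a₀ s, |R a₀ s| ≤ ρ₀ * E a₀ (s + T) * sMass Φ s := by
    intro a₀ s
    have hw := Real.exp_pos (2 * d * (s + T - a₀))
    simp only [hR, hE, hρ₀def]
    rw [abs_mul, abs_of_nonneg (by positivity : (0:ℝ) ≤ 2 * (κ₁ - c₂)), abs_mul, abs_of_pos hw]
    have h := abs_sFlux_le hS π T Φ (s + T)
    rw [add_sub_cancel_right] at h
    calc 2 * (κ₁ - c₂) * (Real.exp (2 * d * (s + T - a₀)) * |sFlux π A T Φ (s + T)|)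
        ≤ 2 * (κ₁ - c₂) * (Real.exp (2 * d * (s + T - a₀)) * (CA * sEnergy Φ (s + T) * sMass Φ s)) :=
          mul_le_mul_of_nonneg_left (mul_le_mul_of_nonneg_left h hw.le) (by positivity)
      _ = 2 * (κ₁ - c₂) * CA * (Real.exp (2 * d * (s + T - a₀)) * sEnergy Φ (s + T)) * sMass Φ s := by ring
  have hEcont : ∀ a₀, Continuous (E a₀) := fun a₀ => by
    have := hΦ.continuous_sEnergy; simp only [hE]; fun_prop
  have hFcont : ∀ a₀, Continuous (F a₀) := fun a₀ => by simp only [hF]; fun_prop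
  have hRcont : ∀ a₀, Continuous (R a₀) := fun a₀ => by
    have : Continuous fun x => sFlux π A T Φ (x + T) := cF.comp (continuous_id.add continuous_const)
    simp only [hR]; fun_prop
  have hEnn : ∀ a₀ s, 0 ≤ E a₀ s := fun a₀ s => by simp only [hE]; exact mul_nonneg (Real.exp_pos _).le (sEnergy_nonneg Φ s)
  have hEev : ∀ a₀ x, S₀ ≤ x → E a₀ x ≤ L * Real.exp (-(2 * d * a₀)) := by
    intro a₀ x hx
    have e1 : Real.exp (2 * d * (x - a₀)) = Real.exp (2 * d * x) * Real.exp (-(2 * d * a₀)) := by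
      rw [← Real.exp_add]; congr 1; ring
    simp only [hE]
    rw [e1, mul_right_comm]
    exact mul_le_mul_of_nonneg_right (hS₀ x hx) (Real.exp_pos _).le
  have hfreq : ∀ a₀ S₁, ∃ S', S₁ ≤ S' ∧ E a₀ S' ≤ L * Real.exp (-(2 * d * a₀)) :=
    fun a₀ S₁ => ⟨max S₁ S₀, le_max_left _ _, hEev a₀ _ (le_max_right _ _)⟩
  have hbd : ∀ a₀ s₁, ∃ B', ∀ s, s₁ ≤ s → E a₀ s ≤ B' := by
    intro a₀ s₁
    obtain ⟨x₀, _, hx₀⟩ := (isCompact_Icc (a := s₁) (b := max s₁ S₀)).exists_isMaxOn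
      (nonempty_Icc.mpr (le_max_left _ _)) (hEcont a₀).continuousOn
    refine ⟨max (E a₀ x₀) (L * Real.exp (-(2 * d * a₀))), fun s hs => ?_⟩
    by_cases h : s ≤ max s₁ S₀
    · exact le_trans (hx₀ ⟨hs, h⟩) (le_max_left _ _)
    · push Not at h
      exact le_trans (hEev a₀ s (le_trans (le_max_right _ _) h.le)) (le_max_right _ _)
  -- CASE 1: the mass exceeds `δ₀` at some `x ≥ S₀ + T`: take `a = x`; plateau from the trailing bound directly
  by_cases hbig : ∃ x, S₀ + T ≤ x ∧ δ₀ < sMass Φ x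
  · obtain ⟨x, hx, hδx⟩ := hbig
    refine Or.inr ⟨x, hδx.le, fun y hy => ?_, fun y hy _ => ?_⟩
    · have := hEev x y (by linarith)
      have h0 : 0 ≤ L * Real.exp (-(2 * d * x)) := by positivity
      simp only [hE] at this; linarith
    · have := hEev x y (by linarith)
      have h0 : 0 ≤ L * Real.exp (-(2 * d * x)) := by positivity
      have h1 : 1 ≤ Real.exp ((2 * (c₂ * CA) * (M + δ₀) + (2 * (c₁ * Real.exp (-(2 * d * T)) - c₂) * CA) * M) * T) :=
        Real.one_le_exp (by positivity)
      simp only [hE] at this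
      nlinarith
  push Not at hbig
  rcases threshold_point' cM hbig with hall | ⟨a, ha, hga⟩
  · refine Or.inl fun x => ?_
    obtain ⟨B', hB'⟩ := hbd 0 x
    have h := plateau_of_small_mass_leak hT hC0 hCTδ hρ₀0 hρA (hFcont 0) (hRcont 0) cM (hEnn 0) (sMass_nonneg Φ)
      (hderivP 0) (hfluxP 0) (hrP 0) hint (fun u _ => hall u) hB' (hfreq 0) x le_rfl
    simp only [hE, sub_zero, mul_zero, neg_zero, Real.exp_zero, mul_one] at h
    exact h
  · refine Or.inr ⟨a, hga, ?_, ?_⟩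
    · obtain ⟨B', hB'⟩ := hbd a (a + T)
      exact plateau_of_small_mass_leak hT hC0 hCTδ hρ₀0 hρA (hFcont a) (hRcont a) cM (hEnn a) (sMass_nonneg Φ)
        (hderivP a) (hfluxP a) (hrP a) hint (fun u hu => ha u (by linarith)) hB' (hfreq a)
    · obtain ⟨B', hB'⟩ := hbd a (a + T)
      have hplat : ∀ s, a + T ≤ s → E a s ≤ 4 * (L * Real.exp (-(2 * d * a))) :=
        plateau_of_small_mass_leak hT hC0 hCTδ hρ₀0 hρA (hFcont a) (hRcont a) cM (hEnn a) (sMass_nonneg Φ)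
          (hderivP a) (hfluxP a) (hrP a) hint (fun u hu => ha u (by linarith)) hB' (hfreq a)
      intro x hx1 hx2
      have h := gap_bound_leak hT hC0 hδ₀.le hM0 (by positivity : (0:ℝ) ≤ 4 * (L * Real.exp (-(2 * d * a)))) hρ₀0
        (hEcont a) (hEnn a) (sMass_nonneg Φ) (hderivP a) (hfluxP a) (hrP a) ha hM hplat x hx1 hx2
      simp only [hE, hCdef, hρ₀def, hκ₁] at h
      exact h

set_option maxHeartbeats 400000 in
/-- **THE WIDE-FRONT INEQUALITY** (see the module docstring): for a non-trivial weakly damped profile family on the surviving side,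
`δ₀² ≤ 32·(γ₁ − c₂)·C_A·A·e^{k}·max(δ₀², q·M²)`, `γ₁ = c₁e^{−2dT}`, `k = (2c₂C_A(M+δ₀) + 2(γ₁−c₂)C_A·M)·T`.
[cite: Tao2016AveragedNS, §4 (4.2)–(4.3), Lemma 4.1 (4.8)–(4.10), §6.4; cell theorems A′/B/B′ + `…LeakyFront`, `…ActionFloor`] -/
theorem IsSWave.asymmetry_mul_action_ge {π : Equiv.Perm ρ} {Q A : V → V} {B : V → V → V}
    {CA d c₁ c₂ T : ℝ} (hS : STable Q A B CA) (hT : 0 < T) (hd : 0 < d) (hc₂ : 0 < c₂)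
    (hc : c₂ ≤ c₁ * Real.exp (-(2 * d * T))) {Φ : ρ → ℝ → V} (hΦ : IsSWave π Q A B d c₁ c₂ T Φ)
    (hG : Integrable (sMass Φ)) {Cb : ℝ} (hB : ∀ r x, ‖Φ r x‖ ≤ Cb)
    {M Aint : ℝ} (hM : ∀ x, sMass Φ x ≤ M) (hA : ∫ x, sMass Φ x ≤ Aint)
    {x₀ P : ℝ} (hbdd : ∀ x, x₀ ≤ x → Real.exp (2 * d * x) * sEnergy Φ x ≤ P) (hne : ∃ r x, Φ r x ≠ 0)
    {δ₀ : ℝ} (hδ₀ : 0 < δ₀) (hCTδ : 8 * (c₂ * CA) * T * δ₀ ≤ 1)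
    (hρA : 4 * (2 * (c₁ * Real.exp (-(2 * d * T)) - c₂) * CA) * Aint ≤ 1) :
    δ₀ ^ 2 ≤ 32 * (c₁ * Real.exp (-(2 * d * T)) - c₂) * CA * Aint
      * Real.exp ((2 * (c₂ * CA) * (M + δ₀) + (2 * (c₁ * Real.exp (-(2 * d * T)) - c₂) * CA) * M) * T)
      * max (δ₀ ^ 2) ((Fintype.card ρ : ℝ) * M ^ 2) := by
  have hCA := hS.CA_nonneg
  have hM0 : 0 ≤ M := le_trans (sMass_nonneg Φ 0) (hM 0)
  set q : ℝ := (Fintype.card ρ : ℝ) with hq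
  have hq0 : 0 ≤ q := by rw [hq]; positivity
  set γ : ℝ := c₁ * Real.exp (-(2 * d * T)) - c₂ with hγ
  have hγ0 : 0 ≤ γ := by rw [hγ]; linarith
  set k : ℝ := (2 * (c₂ * CA) * (M + δ₀) + 2 * γ * CA * M) * T with hkdef
  have hk1 : 1 ≤ Real.exp k := Real.one_le_exp (by rw [hkdef]; positivity)
  have hAint : ∫ x, sMass Φ x ≤ Aint := hA
  have hA0 : 0 ≤ ∫ x, sMass Φ x := integral_nonneg (sMass_nonneg Φ)
  have hAint0 : 0 ≤ Aint := hA0.trans hAint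
  have hmax1 : δ₀ ^ 2 ≤ max (δ₀ ^ 2) (q * M ^ 2) := le_max_left _ _
  have hmax2 : q * M ^ 2 ≤ max (δ₀ ^ 2) (q * M ^ 2) := le_max_right _ _
  have hmax0 : 0 ≤ max (δ₀ ^ 2) (q * M ^ 2) := le_trans (sq_nonneg _) hmax1
  -- the residue
  obtain ⟨Rsq, hR⟩ := hΦ.exists_residue_limit hS hT hG hbdd
  have hRpos : 0 < Rsq := hΦ.residue_pos hS hT hG hR hne
  -- eventually `ẽ ≤ 2 Rsq`
  have hev : ∃ S₀, ∀ x, S₀ ≤ x → Real.exp (2 * d * x) * sEnergy Φ x ≤ 2 * Rsq := by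
    have h := (hR.eventually (gt_mem_nhds (by linarith : Rsq < 2 * Rsq)))
    obtain ⟨S₀, hS₀⟩ := eventually_atTop.1 h
    exact ⟨S₀, fun x hx => (hS₀ x hx).le⟩
  -- interval integrals of the mass are below the total mass
  have hint : ∀ a b, a ≤ b → ∫ x in a..b, sMass Φ x ≤ Aint := by
    intro a b hab
    rw [intervalIntegral.integral_of_le hab]
    exact (setIntegral_le_integral hG (Eventually.of_forall (sMass_nonneg Φ))).trans hAint
  -- the scalar wake–throughput inequality in the frame with weight origin `a₀`
  have hwake : ∀ a₀ P', (∀ x, Real.exp (2 * d * (x - a₀)) * sEnergy Φ x ≤ P') →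
      Rsq * Real.exp (-(2 * d * a₀)) ≤ 2 * |γ| * (CA * P' * ∫ σ, sMass Φ σ) := by
    intro a₀ P' hP'
    set κ : ℝ := Real.exp (-(2 * d * a₀)) with hκ
    have hκpos : 0 < κ := Real.exp_pos _
    have ew : ∀ x, Real.exp (2 * d * (x - a₀)) = κ * Real.exp (2 * d * x) := by
      intro x; rw [hκ, ← Real.exp_add]; congr 1; ring
    refine residue_le_asymmetry (e := fun x => Real.exp (2 * d * (x - a₀)) * sEnergy Φ x)
      (f := fun x => κ * (Real.exp (2 * d * x) * sFlux π A T Φ x)) (g := sMass Φ) (T := T)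
      (c₁ := c₁ * Real.exp (-(2 * d * T))) (c₂ := c₂) hCA (by have := hΦ.continuous_sFlux hS; fun_prop)
      (fun x => mul_nonneg (Real.exp_pos _).le (sEnergy_nonneg Φ x)) (sMass_nonneg Φ) ?_ ?_ hG hP' ?_ ?_
    · intro s
      have h := (hΦ.hasDerivAt_weighted_sEnergy hS s).const_mul κ
      have hfun : (fun x => κ * (Real.exp (2 * d * x) * sEnergy Φ x)) = fun x => Real.exp (2 * d * (x - a₀)) * sEnergy Φ x := by
        funext x; rw [ew x]; ring
      rw [hfun] at h
      refine h.congr_deriv ?_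
      ring
    · intro σ
      have h := hΦ.abs_weighted_sFlux_le hS σ
      rw [abs_mul, abs_of_pos hκpos, ew σ]
      calc κ * |Real.exp (2 * d * σ) * sFlux π A T Φ σ| ≤ κ * (CA * (Real.exp (2 * d * σ) * sEnergy Φ σ) * sMass Φ (σ - T)) :=
            mul_le_mul_of_nonneg_left h hκpos.le
        _ = CA * (κ * Real.exp (2 * d * σ) * sEnergy Φ σ) * sMass Φ (σ - T) := by ring
    · have h := (tendsto_weighted_sEnergy_atBot hd hB).const_mul κ
      rw [mul_zero] at h
      refine h.congr fun x => ?_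
      rw [ew x]; ring
    · have h := hR.const_mul κ
      have : κ * Rsq = Rsq * Real.exp (-(2 * d * a₀)) := by rw [hκ, mul_comm]
      rw [this] at h
      refine h.congr fun x => ?_
      rw [ew x]; ring
  have habsγ : |γ| = γ := abs_of_nonneg hγ0
  -- the common final step: `1 ≤ c·γ·CA·A·e^k` with `c ≤ 32` gives the claim
  have hfinal : ∀ c : ℝ, c ≤ 32 → 1 ≤ c * γ * CA * Aint * Real.exp k →
      δ₀ ^ 2 ≤ 32 * γ * CA * Aint * Real.exp k * max (δ₀ ^ 2) (q * M ^ 2) := by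
    intro c hc32 h1
    have hX : 0 ≤ γ * CA * Aint * Real.exp k := by positivity
    have h2 : 1 ≤ 32 * γ * CA * Aint * Real.exp k := by nlinarith
    calc δ₀ ^ 2 ≤ max (δ₀ ^ 2) (q * M ^ 2) := hmax1
      _ = 1 * max (δ₀ ^ 2) (q * M ^ 2) := (one_mul _).symm
      _ ≤ (32 * γ * CA * Aint * Real.exp k) * max (δ₀ ^ 2) (q * M ^ 2) :=
          mul_le_mul_of_nonneg_right h2 hmax0
  -- the dichotomy
  rcases IsSWave.leaky_front_dichotomy hS hT hc₂ hc hΦ hM (by positivity : (0:ℝ) ≤ 2 * Rsq) hev hint hδ₀ hCTδ hρA with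
    hflat | ⟨a, hga, hplat, hgap⟩
  · -- no front: peak ≤ 8 Rsq, so `1 ≤ 16 γ CA A`
    have hP' : ∀ x, Real.exp (2 * d * (x - 0)) * sEnergy Φ x ≤ 4 * (2 * Rsq) := fun x => by rw [sub_zero]; exact hflat x
    have h := hwake 0 (4 * (2 * Rsq)) hP'
    rw [mul_zero, neg_zero, Real.exp_zero, mul_one, habsγ] at h
    refine hfinal 16 (by norm_num) ?_
    have h2 : Rsq * 1 ≤ Rsq * (16 * γ * CA * ∫ σ, sMass Φ σ) := by
      have e : Rsq * (16 * γ * CA * ∫ σ, sMass Φ σ) = 2 * γ * (CA * (4 * (2 * Rsq)) * ∫ σ, sMass Φ σ) := by ring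
      rw [mul_one, e]; exact h
    have h3 := le_of_mul_le_mul_left h2 hRpos
    have h4 : 16 * γ * CA * (∫ σ, sMass Φ σ) ≤ 16 * γ * CA * Aint := mul_le_mul_of_nonneg_left hAint (by positivity)
    have h5 : 16 * γ * CA * Aint ≤ 16 * γ * CA * Aint * Real.exp k := by
      have : 0 ≤ 16 * γ * CA * Aint := by positivity
      nlinarith
    linarith
  · -- a front with leading edge `a`: peak in the `a`-frame ≤ max(M², 16 Rsq_a e^k)
    set Ra : ℝ := Rsq * Real.exp (-(2 * d * a)) with hRa
    have hRa0 : 0 < Ra := by rw [hRa]; positivity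
    have hLa : 2 * Rsq * Real.exp (-(2 * d * a)) = 2 * Ra := by rw [hRa]; ring
    rw [hLa] at hplat hgap
    rw [← hγ] at hgap
    rw [← hkdef] at hgap
    set Pa : ℝ := max (M ^ 2) (16 * Ra * Real.exp k) with hPa
    have hgap' : ∀ x, a ≤ x → x ≤ a + T → Real.exp (2 * d * (x - a)) * sEnergy Φ x ≤ 16 * Ra * Real.exp k := by
      intro x h1 h2; have := hgap x h1 h2; linarith
    have hpeak : ∀ x, Real.exp (2 * d * (x - a)) * sEnergy Φ x ≤ Pa := by
      intro x
      rcases lt_or_ge x a with hxa | hxa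
      · -- ahead of the leading edge: weight ≤ 1 and `E ≤ sMass² ≤ M²`
        have hw : Real.exp (2 * d * (x - a)) ≤ 1 := by
          rw [Real.exp_le_one_iff]; nlinarith
        have hE : sEnergy Φ x ≤ M ^ 2 := (sEnergy_le_sMass_sq' Φ x).trans
          (pow_le_pow_left₀ (sMass_nonneg Φ x) (hM x) 2)
        calc Real.exp (2 * d * (x - a)) * sEnergy Φ x ≤ 1 * M ^ 2 :=
              mul_le_mul hw hE (sEnergy_nonneg Φ x) zero_le_one
          _ ≤ Pa := by rw [one_mul]; exact le_max_left _ _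
      · rcases le_or_gt x (a + T) with hxT | hxT
        · exact (hgap' x hxa hxT).trans (le_max_right _ _)
        · have h := hplat x hxT.le
          calc Real.exp (2 * d * (x - a)) * sEnergy Φ x ≤ 4 * (2 * Ra) := h
            _ ≤ 16 * Ra * Real.exp k := by nlinarith [hk1, hRa0]
            _ ≤ Pa := le_max_right _ _
    have hw := hwake a Pa hpeak
    rw [habsγ, ← hRa] at hw
    -- the A′ floor at the leading edge: `δ₀² ≤ q·E(a) ≤ 16 q Ra e^k`
    have hfloor : δ₀ ^ 2 ≤ q * (16 * Ra * Real.exp k) := by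
      have h1 : δ₀ ^ 2 ≤ sMass Φ a ^ 2 := by nlinarith [hga, hδ₀]
      have h2 := sMass_sq_le_card_mul_sEnergy Φ a
      have h3 := hgap' a le_rfl (by linarith)
      rw [sub_self, mul_zero, Real.exp_zero, one_mul] at h3
      rw [← hq] at h2
      nlinarith [mul_le_mul_of_nonneg_left h3 hq0]
    -- case split on the peak
    rcases le_total (M ^ 2) (16 * Ra * Real.exp k) with hcase | hcase
    · have hPa' : Pa = 16 * Ra * Real.exp k := by rw [hPa, max_eq_right hcase]
      rw [hPa'] at hw
      refine hfinal 32 le_rfl ?_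
      have h2 : Ra * 1 ≤ Ra * (32 * γ * CA * Real.exp k * ∫ σ, sMass Φ σ) := by
        have e : Ra * (32 * γ * CA * Real.exp k * ∫ σ, sMass Φ σ)
            = 2 * γ * (CA * (16 * Ra * Real.exp k) * ∫ σ, sMass Φ σ) := by ring
        rw [mul_one, e]; exact hw
      have h3 := le_of_mul_le_mul_left h2 hRa0
      have h4 : 32 * γ * CA * Real.exp k * (∫ σ, sMass Φ σ) ≤ 32 * γ * CA * Real.exp k * Aint :=
        mul_le_mul_of_nonneg_left hAint (by positivity)
      linarith
    · have hPa' : Pa = M ^ 2 := by rw [hPa, max_eq_left hcase]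
      rw [hPa'] at hw
      have h1 : Ra ≤ 2 * γ * CA * M ^ 2 * Aint := by
        have h4 : 2 * γ * (CA * M ^ 2 * ∫ σ, sMass Φ σ) ≤ 2 * γ * (CA * M ^ 2 * Aint) :=
          mul_le_mul_of_nonneg_left (mul_le_mul_of_nonneg_left hAint (by positivity)) (by positivity)
        linarith
      have h2 : δ₀ ^ 2 ≤ 32 * γ * CA * Aint * Real.exp k * (q * M ^ 2) := by
        have h5 : q * (16 * Ra * Real.exp k) ≤ q * (16 * (2 * γ * CA * M ^ 2 * Aint) * Real.exp k) := by
          have : 16 * Ra * Real.exp k ≤ 16 * (2 * γ * CA * M ^ 2 * Aint) * Real.exp k :=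
            mul_le_mul_of_nonneg_right (by linarith) (Real.exp_pos _).le
          exact mul_le_mul_of_nonneg_left this hq0
        have h6 : q * (16 * (2 * γ * CA * M ^ 2 * Aint) * Real.exp k) = 32 * γ * CA * Aint * Real.exp k * (q * M ^ 2) := by
          ring
        linarith [hfloor]
      calc δ₀ ^ 2 ≤ 32 * γ * CA * Aint * Real.exp k * (q * M ^ 2) := h2
        _ ≤ (32 * γ * CA * Aint * Real.exp k) * max (δ₀ ^ 2) (q * M ^ 2) :=
            mul_le_mul_of_nonneg_left hmax2 (by positivity)

end Summit.NavierStokesRegularity.NavierStokesRegularity.Theorems.NoSurvivingDSSOne.LeakyFront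

end
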